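import Summits.BirchSwinnertonDyer.BirchSwinnertonDyer.Theorems.ManinLocalTwoThreeQRemainderCalculus
import HarnessLib

/-!
# The coefficient bridge: a remainder estimate `f = P(q) + o(q^m)` PINS the first `m + 1` `q`-coefficients of `f`

Cell bsd-f2-manin, route `ManinLocalTwoThree`, prover seat p3 gen 23.  Companion of `ManinLocalTwoThreeQRemainderCalculus`: there
`tendsto_of_hasSum` turns the `q`-expansion into a remainder estimate; here the CONVERSE — if `f : ℍ → ℂ` is `1`-periodic,
holomorphic and bounded at `i∞` (so that it has a `q`-expansion, `UpperHalfPlane.hasSum_qExpansion`) and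
`(f(τ) − P(q))/q^m → 0` at `i∞` for a polynomial `P` of degree `≤ m`, then `(qExpansion 1 f).coeff n = P.coeff n` for all `n ≤ m`
(`qExpansion_coeff_eq_of_tendsto`).  The engine is the elementary `eq_zero_of_tendsto_eval_div_pow`: a polynomial `R` of degree
`≤ m` with `R(q)/q^m → 0` as `q = e^{2πiτ} → 0` is `0` (induction on `m`: `R(q) → R(0)` forces `R(0) = 0`, then divide by `X`).
USE (level `64` pinning and beyond): exact Fourier coefficients `a₅`, `a₂₅`, … of explicit `η`-quotients from the `ring`-checked
truncations of the remainder calculus, to feed `qExpansion_coeff_heckeT` (Hecke eigenvalue separation) and the Sturm bound.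
Pure analysis; nothing here is specific to BSD. [cite: DiamondShurman2005, §1.1]
-/

set_option autoImplicit false
set_option linter.dupNamespace false

noncomputable section

open Complex Filter Topology Set Asymptotics Polynomial
open UpperHalfPlane hiding I
open scoped Real Topology Manifold MatrixGroups
open Literature.NumberTheory.EllipticCurves Literature.NumberTheory.EllipticCurves.ModularForms

namespace Summit.BirchSwinnertonDyer.BirchSwinnertonDyer.Theorems.ManinLocalTwoThree.QCoefficientBridge

open QRemainder

/-- **A polynomial `R` with `deg R ≤ m` and `R(q)/q^m → 0` at `i∞` is zero** (`q = e^{2πiτ} → 0`, `q ≠ 0`). [folklore] -/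
theorem eq_zero_of_tendsto_eval_div_pow :
    ∀ (m : ℕ) (R : ℂ[X]), R.natDegree ≤ m →
      Tendsto (fun τ : ℍ ↦ R.eval (Function.Periodic.qParam 1 (τ : ℂ)) / Function.Periodic.qParam 1 (τ : ℂ) ^ m)
        atImInfty (𝓝 0) → R = 0 := by
  intro m
  induction m with
  | zero =>
    intro R hR h
    rw [Polynomial.eq_C_of_natDegree_le_zero hR] at h ⊢
    simp only [eval_C, pow_zero, div_one] at h
    have hc : R.coeff 0 = 0 := tendsto_nhds_unique tendsto_const_nhds h
    rw [hc, map_zero]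
  | succ m ih =>
    intro R hR h
    -- `R(q) → 0` and `R(q) → R(0)`, so `R(0) = 0`
    have h0 : Tendsto (fun τ : ℍ ↦ R.eval (Function.Periodic.qParam 1 (τ : ℂ))) atImInfty (𝓝 0) := by
      have h' := h.mul (tendsto_qParam.pow (m + 1))
      rw [zero_mul] at h'
      refine h'.congr fun τ ↦ ?_
      rw [div_mul_cancel₀ _ (pow_ne_zero _ (qParam_ne_zero τ))]
    have h0' : Tendsto (fun τ : ℍ ↦ R.eval (Function.Periodic.qParam 1 (τ : ℂ))) atImInfty (𝓝 (R.eval 0)) :=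
      (R.continuous.tendsto 0).comp tendsto_qParam
    have hR0 : R.eval 0 = 0 := (tendsto_nhds_unique h0' h0)
    have hX : X ∣ R := by
      rw [Polynomial.X_dvd_iff, Polynomial.coeff_zero_eq_eval_zero, hR0]
    obtain ⟨R', rfl⟩ := hX
    by_cases hR' : R' = 0
    · rw [hR', mul_zero]
    have hdeg : R'.natDegree ≤ m := by
      have := Polynomial.natDegree_X_mul hR'
      omega
    have h'' : Tendsto (fun τ : ℍ ↦ R'.eval (Function.Periodic.qParam 1 (τ : ℂ))
        / Function.Periodic.qParam 1 (τ : ℂ) ^ m) atImInfty (𝓝 0) := by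
      refine h.congr fun τ ↦ ?_
      have hq := qParam_ne_zero τ
      rw [eval_mul, eval_X, pow_succ]
      field_simp
    rw [ih R' hdeg h'', mul_zero]

/-- **The coefficient bridge.**  If `f : ℍ → ℂ` is `1`-periodic, holomorphic and bounded at `i∞`, `deg P ≤ m`, and
`(f(τ) − P(q))/q^m → 0` at `i∞`, then the `q`-expansion coefficients of `f` up to `m` are those of `P`. [cite: DiamondShurman2005, §1.1] -/
theorem qExpansion_coeff_eq_of_tendsto {f : ℍ → ℂ} (hper : Function.Periodic (f ∘ ofComplex) 1)
    (hmd : MDifferentiable 𝓘(ℂ) 𝓘(ℂ) f) (hbd : IsBoundedAtImInfty f) {P : ℂ[X]} {m : ℕ} (hP : P.natDegree ≤ m)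
    (h : Tendsto (fun τ : ℍ ↦ (f τ - P.eval (Function.Periodic.qParam 1 (τ : ℂ)))
      / Function.Periodic.qParam 1 (τ : ℂ) ^ m) atImInfty (𝓝 0)) :
    ∀ n ≤ m, (qExpansion 1 f).coeff n = P.coeff n := by
  set c : ℕ → ℂ := fun n ↦ (qExpansion 1 f).coeff n with hc
  have hf := tendsto_of_hasSum hper hmd hbd (c := c)
    (fun τ ↦ by simpa [hc] using UpperHalfPlane.hasSum_qExpansion one_pos hper hmd hbd τ) m
  -- `R = P − P_f` has `R(q)/q^m → 0`
  have hR := QRemainder.sub h hf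
  have hR' : Tendsto (fun τ : ℍ ↦ (P - ∑ n ∈ Finset.range (m + 1), C (c n) * X ^ n).eval
      (Function.Periodic.qParam 1 (τ : ℂ)) / Function.Periodic.qParam 1 (τ : ℂ) ^ m) atImInfty (𝓝 0) := by
    have h2 := hR.neg
    rw [neg_zero] at h2
    refine h2.congr fun τ ↦ ?_
    ring
  have hdeg : (P - ∑ n ∈ Finset.range (m + 1), C (c n) * X ^ n).natDegree ≤ m := by
    refine (Polynomial.natDegree_sub_le _ _).trans (max_le hP ?_)
    refine Polynomial.natDegree_sum_le_of_forall_le _ _ fun n hn ↦ ?_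
    refine (Polynomial.natDegree_C_mul_le _ _).trans ?_
    rw [Polynomial.natDegree_X_pow]
    exact Nat.lt_succ_iff.mp (Finset.mem_range.mp hn)
  have hzero := eq_zero_of_tendsto_eval_div_pow m _ hdeg hR'
  intro n hn
  have hPn := congrArg (fun Q : ℂ[X] ↦ Q.coeff n) hzero
  simp only [coeff_sub, coeff_zero, finsetSum_coeff, coeff_C_mul, coeff_X_pow] at hPn
  rw [Finset.sum_eq_single n (fun k _ hk ↦ by simp [Ne.symm hk]) (fun hn' ↦ absurd
    (Finset.mem_range.mpr (Nat.lt_succ_of_le hn)) hn')] at hPn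
  simp only [if_true, mul_one] at hPn
  rw [hc] at hPn
  linear_combination -hPn

/-- **Cusp-form version**: for `f ∈ S_k(Γ₀(N))`, a remainder estimate `f = P(q) + o(q^m)` with `deg P ≤ m` gives
`(qExpansion 1 f).coeff n = P.coeff n` for `n ≤ m`. [cite: DiamondShurman2005, §1.1] -/
theorem qExpansion_coeff_cuspForm_eq_of_tendsto {N : ℕ} [NeZero N] {k : ℤ} (f : CuspForm (CongruenceSubgroup.Gamma0 N) k)
    {P : ℂ[X]} {m : ℕ} (hP : P.natDegree ≤ m)
    (h : Tendsto (fun τ : ℍ ↦ (f τ - P.eval (Function.Periodic.qParam 1 (τ : ℂ)))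
      / Function.Periodic.qParam 1 (τ : ℂ) ^ m) atImInfty (𝓝 0)) :
    ∀ n ≤ m, (qExpansion 1 ⇑f).coeff n = P.coeff n := by
  have hb : IsBoundedAtImInfty (⇑f : ℍ → ℂ) := by
    have h1 := ModularFormClass.bdd_at_infty_slash f (1 : SL(2, ℤ))
    rwa [SlashAction.slash_one] at h1
  exact qExpansion_coeff_eq_of_tendsto
    (SlashInvariantFormClass.periodic_comp_ofComplex f (one_mem_strictPeriods_coe_gamma0 N))
    (ModularFormClass.holo f) hb hP h

end Summit.BirchSwinnertonDyer.BirchSwinnertonDyer.Theorems.ManinLocalTwoThree.QCoefficientBridge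

end
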